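import Mathlib
import Summits.NavierStokesRegularity.NavierStokesRegularity.Theorems.TaoLadderRungTwoBreakBlowupRigidityOnePinnedExtraction
import Summits.NavierStokesRegularity.NavierStokesRegularity.Theorems.TaoLadderRungTwoBreakBlowupRigidityOnePeriodicCompanionBounded
import Summits.NavierStokesRegularity.NavierStokesRegularity.Theses.TaoLadderRungTwoBreak
import HarnessLib

/-!
# THE CRUX K2(1) `TaoLadderRungTwoBreak.BlowupRigidityOne` (stmt-NavierStokesRegularity-20206) BY NAME from ONE
  blow-up-side bundle: a TYPE-I PINNED robust blow-up whose renormalised flow is ASYMPTOTICALLY SHIFT-PERIODIC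
  along its firing centres («robust blow-up is asymptotically DSS») — periodicity passes through the ω-limit
  extraction, and a periodic bounded surviving eternal limit IS a surviving DSS wave

MODEL lattice ODEs only (Tao 2016 §4 (4.8)/(4.12), §6.4); nothing here is a statement about the Navier–Stokes
equations; NO item is closed (`--supports stmt-NavierStokesRegularity-20206`). Route-independent (general `m`;
`m = 4` in the crux-shaped corollary); DEF-FREE. Built on the g0 hand's pinned extraction
(`admissibleEternalLimit_of_ceilings`, `survivingFwd_of_firingLimit`, p817233/p817364/p817525) and this hand's
dictionary (`exists_survivingDSSWave_iff_shiftPeriodic`, p819433).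

* `shiftPeriodic_of_translateLimit` — abstract transfer: if translates `g_j` converge continuously along `φ` to
  `W∞` and `g_j (n+q) (u + c) - g_j n u → 0` pointwise, then `W∞_{n+q}(u + c) = W∞_n(u)`;
* `periodicSurvivingEternalLimit_of_pinned` — the pinned extraction (type I, action ceiling, energy ceiling
  `Cₑ μ^k`, firing floor with two-sided clock, `Λ²μ > 1`, weight threshold) PLUS asymptotic `(q, T')`-periodicity
  of the renormalised flow relative to its firing centres `s_j = -log(T - τ_j)`
  (`W̃_{n+q+j}(σ + qT' + s_j) - W̃_{n+j}(σ + s_j) → 0`) yields an admissible, uniformly bounded, forward-surviving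
  eternal limit that is EXACTLY shift-periodic `W∞_{n+q}(σ) = W∞_n(σ - qT')`;
* `survivingDSSWave_of_periodicPinned` — at `a = 1` (`(1+ε₀)⁻¹ ≤ μ`, `T' > 0`, `e^{2T'} < (1+ε₀)^5`): a
  non-trivial (S₁)-surviving admissible DSS wave of the table — the CONCLUSION OF THE CRUX for that table;
* `blowupRigidityOne_of_periodicPinnedBlowups` — **`BlowupRigidityOne` BY NAME** from the single hypothesis that
  below a threshold every robust blow-up of an `E₂(R)` table admits such a type-I pinned, asymptotically
  shift-periodic exact flow. No classification stub is used.

HONEST LABEL: the hypothesis bundle (type I N-39 + pinning (E2) + asymptotic periodicity of the renormalised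
blow-up = «asymptotic self-similarity of robust inviscid blow-up at fixed spread») is OPEN and research-level;
this file only shows it is SUFFICIENT for the crux as typed. No stub, crux or summit is proved; rung 0.
-/

noncomputable section

-- the summit and its single sub-problem share the name (CONVENTIONS §1)
set_option linter.dupNamespace false

open Set Filter Topology MeasureTheory

namespace Summit.NavierStokesRegularity.NavierStokesRegularity.Theorems

namespace BlowupRigidityOne

open Literature.Analysis.FluidPDE Literature.Analysis.FluidPDE.TaoCascade
open Summit.NavierStokesRegularity.NavierStokesRegularity.Theses.TaoLadderRungTwoBreak

variable {m : ℕ}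

/-- **Asymptotic periodicity of translates passes to continuous limits as exact periodicity.**
[cite: Tao2016AveragedNS, §6.4; folklore (uniqueness of limits)] -/
theorem shiftPeriodic_of_translateLimit {E : Type*} [NormedAddCommGroup E]
    {g : ℕ → ℤ → ℝ → E} {φ : ℕ → ℕ} (hφ : StrictMono φ) {Wlim : ℤ → ℝ → E}
    (hconv : ∀ (n : ℤ) (u : ℕ → ℝ) (σ : ℝ), Tendsto u atTop (𝓝 σ) →
      Tendsto (fun j => g (φ j) n (u j)) atTop (𝓝 (Wlim n σ)))
    {q : ℤ} {c : ℝ}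
    (hasym : ∀ (n : ℤ) (u : ℝ), Tendsto (fun j => g j (n + q) (u + c) - g j n u) atTop (𝓝 0))
    (n : ℤ) (u : ℝ) : Wlim (n + q) (u + c) = Wlim n u := by
  have h1 : Tendsto (fun j => g (φ j) (n + q) (u + c)) atTop (𝓝 (Wlim (n + q) (u + c))) :=
    hconv (n + q) (fun _ => u + c) (u + c) tendsto_const_nhds
  have h2 : Tendsto (fun j => g (φ j) n u) atTop (𝓝 (Wlim n u)) := hconv n (fun _ => u) u tendsto_const_nhds
  have h3 : Tendsto (fun j => g (φ j) (n + q) (u + c) - g (φ j) n u) atTop (𝓝 0) :=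
    (hasym n u).comp hφ.tendsto_atTop
  exact sub_eq_zero.1 (tendsto_nhds_unique (h1.sub h2) h3)

/-- **PERIODIC SURVIVING ETERNAL ω-LIMIT OF A PINNED, ASYMPTOTICALLY SHIFT-PERIODIC INVISCID BLOW-UP (general `a`).**
Hypotheses of `survivingEternalLimit_of_pinned` (exact flow on `[0,T)`, renormalisation `W̃`, type I, action ceiling,
energy ceiling `Cₑ μ^k`, firing floor `c_f μ^k` with two-sided clock, `Λ²μ > 1`, `1 ≤ physWeight a ε₀ · Λ²μ`) PLUS
asymptotic `(q,T')`-periodicity of `W̃` relative to the firing centres `s_j = -log(T - τ_j)`: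
`W̃_{n+q+j}(σ + qT' + s_j) - W̃_{n+j}(σ + s_j) → 0` for every `n, σ`. Conclusion: an admissible, uniformly bounded,
forward (S_a)-surviving eternal solution that is shift-periodic, `W∞_{n+q}(σ) = W∞_n(σ - qT')`.
[cite: Tao2016AveragedNS, §4 Thm. 4.2 (statement shape), (4.8)–(4.10), §6.4; KochNadirashviliSereginSverak2009, Thm 1.1 ff.; cell vocabulary (`IsEternal`, `UniformBound`, `EternalSurvivingFwd`)] -/
theorem periodicSurvivingEternalLimit_of_pinned {ε₀ T C A μ Cₑ cf κ₁ κ₂ a T' : ℝ} (hε : 0 < ε₀) (hT : 0 < T)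
    {α : Fin m → Fin m → Fin m → ℤ × ℤ × ℤ → ℝ}
    {X : Fin m → ℤ → ℝ → ℝ} (hC1 : ∀ i n, ContDiffOn ℝ 1 (X i n) (Set.Ico 0 T))
    (hmot : ∀ i n t, 0 ≤ t → t < T → derivWithin (X i n) (Set.Ici 0) t = quadTerm ε₀ α X i n t)
    {W : ℤ → ℝ → Em m}
    (hW : ∀ n σ, W n σ = (bigLam ε₀ ^ n * Real.exp (-σ)) • shellVec X n (T - Real.exp (-σ)))
    (htypeI : ∀ (n : ℤ) (t : ℝ), 0 ≤ t → t < T → bigLam ε₀ ^ n * (T - t) * ‖shellVec X n t‖ ≤ C)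
    (hact : ∀ k : ℤ, IntegrableOn (fun t => ‖shellVec X k t‖) (Ico 0 T) ∧
      bigLam ε₀ ^ k * (∫ t in Ico 0 T, ‖shellVec X k t‖) ≤ A)
    (hμ : 0 < μ) (hE : ∀ (k : ℤ) (t : ℝ), 0 ≤ t → t < T → ‖shellVec X k t‖ ^ 2 ≤ Cₑ * μ ^ k)
    {τ : ℕ → ℝ} (hτ : ∀ k : ℕ, 0 ≤ τ k ∧ τ k < T)
    (hfloor : ∀ k : ℕ, cf * μ ^ k ≤ ‖shellVec X (k : ℤ) (τ k)‖ ^ 2)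
    (hclock₁ : ∀ k : ℕ, κ₁ ≤ (bigLam ε₀ ^ 2 * μ) ^ k * (T - τ k) ^ 2)
    (hclock₂ : ∀ k : ℕ, (bigLam ε₀ ^ 2 * μ) ^ k * (T - τ k) ^ 2 ≤ κ₂)
    (hcf : 0 < cf) (hκ₁ : 0 < κ₁) (hκ₂ : 0 < κ₂) (hq1 : 1 < bigLam ε₀ ^ 2 * μ)
    (hpw : 1 ≤ physWeight a ε₀ * (bigLam ε₀ ^ 2 * μ)) {q : ℕ}
    (hasym : ∀ (n : ℤ) (σ : ℝ), Tendsto (fun j : ℕ =>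
      W (n + q + (j : ℤ)) (σ + q * T' + -Real.log (T - τ j)) - W (n + (j : ℤ)) (σ + -Real.log (T - τ j)))
        atTop (𝓝 0)) :
    ∃ Wlim : ℤ → ℝ → Em m, IsEternal ε₀ α Wlim ∧ UniformBound Wlim ∧ EternalSurvivingFwd a ε₀ Wlim ∧
      (∀ (n : ℤ) (σ : ℝ), Wlim (n + q) σ = Wlim n (σ - q * T')) := by
  have hΛ : 0 < bigLam ε₀ := bigLam_pos (by linarith)
  set Q : ℝ := bigLam ε₀ ^ 2 * μ with hQ_def
  have hQ : 0 < Q := by positivity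
  -- the firing-centred centring (as in `survivingEternalLimit_of_pinned`)
  have gap : ∀ j : ℕ, 0 < T - τ j := fun j => by linarith [(hτ j).2]
  have hlow : ∀ j : ℕ, ((j : ℝ) * Real.log Q - Real.log κ₂) / 2 ≤ -Real.log (T - τ j) := by
    intro j
    have h1 : (T - τ j) ^ 2 ≤ κ₂ / Q ^ j := by
      rw [le_div_iff₀ (pow_pos hQ j), mul_comm]; exact hclock₂ j
    have h2 : Real.log ((T - τ j) ^ 2) ≤ Real.log (κ₂ / Q ^ j) := Real.log_le_log (pow_pos (gap j) 2) h1
    rw [Real.log_pow, Real.log_div hκ₂.ne' (pow_pos hQ j).ne', Real.log_pow] at h2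
    push_cast at h2
    linarith
  have hs : Tendsto (fun j : ℕ => -Real.log (T - τ j)) atTop atTop := by
    have hlq : 0 < Real.log Q := Real.log_pos hq1
    have h1 : Tendsto (fun j : ℕ => ((j : ℝ) * Real.log Q + -Real.log κ₂) / 2) atTop atTop :=
      (tendsto_atTop_add_const_right _ _ (tendsto_natCast_atTop_atTop.atTop_mul_const hlq)).atTop_div_const
        two_pos
    refine tendsto_atTop_mono (fun j => ?_) h1
    have := hlow j
    rwa [sub_eq_add_neg] at this
  have hM : ∀ j : ℕ, Q ^ ((fun j : ℕ => (j : ℤ)) j) * Real.exp (-(2 * (fun j : ℕ => -Real.log (T - τ j)) j)) ≤ κ₂ := by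
    intro j
    have e : Real.exp (-(2 * -Real.log (T - τ j))) = (T - τ j) ^ 2 := by
      rw [show -(2 * -Real.log (T - τ j)) = Real.log (T - τ j) + Real.log (T - τ j) by ring, Real.exp_add,
        Real.exp_log (gap j), sq]
    simp only [zpow_natCast, e]
    exact hclock₂ j
  obtain ⟨φ, hφ, Wlim, hconv, hEt, hUB, -, -⟩ := admissibleEternalLimit_of_ceilings hε hT hC1 hmot hW htypeI hact
    hμ hE (fun j : ℕ => (j : ℤ)) (fun j : ℕ => -Real.log (T - τ j)) hs hM
  have hconv' : ∀ (n : ℤ) (v : ℕ → ℝ) (σ : ℝ), Tendsto v atTop (𝓝 σ) →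
      Tendsto (fun j => W (n + ((φ j : ℕ) : ℤ)) (v j + -Real.log (T - τ (φ j)))) atTop (𝓝 (Wlim n σ)) :=
    fun n v σ hv => by simpa only using hconv n v σ hv
  -- periodicity transfer along the firing-centred translates
  have hper : ∀ (n : ℤ) (u : ℝ), Wlim (n + q) (u + q * T') = Wlim n u := by
    refine shiftPeriodic_of_translateLimit (g := fun j n u => W (n + (j : ℤ)) (u + -Real.log (T - τ j))) hφ
      (fun n u σ hu => hconv n u σ hu) (q := (q : ℤ)) (c := q * T') (fun n u => ?_)
    refine (hasym n u).congr fun j => ?_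
    simp only [add_assoc]
  refine ⟨Wlim, hEt, hUB,
    survivingFwd_of_firingLimit hε hW hμ hcf hκ₁ hκ₂ hq1 hpw hτ hfloor hclock₁ hclock₂ (φ := φ) hconv',
    fun n σ => ?_⟩
  have h := hper n (σ - q * T')
  rw [sub_add_cancel] at h
  exact h

/-- **THE CRUX'S CONCLUSION FOR ONE TABLE (`a = 1`).** A type-I pinned inviscid blow-up of `α` at an (S₁)-surviving
energy ratio `(1+ε₀)⁻¹ ≤ μ`, whose renormalised flow is asymptotically `(q,T')`-periodic along its firing centres
with `q ≥ 1`, `T' > 0` and sub-unitary `e^{2T'}/(1+ε₀)^5 < 1`, yields a NON-TRIVIAL (S₁)-SURVIVING ADMISSIBLE DSS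
WAVE of `α` (periodic bounded surviving eternal limit ⇒ wave, `exists_survivingDSSWave_iff_shiftPeriodic`).
[cite: Tao2016AveragedNS, §4 Thm. 4.2, (4.8)–(4.10), §6.4; KochNadirashviliSereginSverak2009, Thm 1.1 ff.; cell vocabulary (`IsDSSWave`, `Surviving`)] -/
theorem survivingDSSWave_of_periodicPinned {ε₀ T C A μ Cₑ cf κ₁ κ₂ T' : ℝ} (hε : 0 < ε₀) (hT : 0 < T)
    {α : Fin m → Fin m → Fin m → ℤ × ℤ × ℤ → ℝ}
    {X : Fin m → ℤ → ℝ → ℝ} (hC1 : ∀ i n, ContDiffOn ℝ 1 (X i n) (Set.Ico 0 T))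
    (hmot : ∀ i n t, 0 ≤ t → t < T → derivWithin (X i n) (Set.Ici 0) t = quadTerm ε₀ α X i n t)
    {W : ℤ → ℝ → Em m}
    (hW : ∀ n σ, W n σ = (bigLam ε₀ ^ n * Real.exp (-σ)) • shellVec X n (T - Real.exp (-σ)))
    (htypeI : ∀ (n : ℤ) (t : ℝ), 0 ≤ t → t < T → bigLam ε₀ ^ n * (T - t) * ‖shellVec X n t‖ ≤ C)
    (hact : ∀ k : ℤ, IntegrableOn (fun t => ‖shellVec X k t‖) (Ico 0 T) ∧
      bigLam ε₀ ^ k * (∫ t in Ico 0 T, ‖shellVec X k t‖) ≤ A)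
    (hμ1 : (1 + ε₀)⁻¹ ≤ μ) (hE : ∀ (k : ℤ) (t : ℝ), 0 ≤ t → t < T → ‖shellVec X k t‖ ^ 2 ≤ Cₑ * μ ^ k)
    {τ : ℕ → ℝ} (hτ : ∀ k : ℕ, 0 ≤ τ k ∧ τ k < T)
    (hfloor : ∀ k : ℕ, cf * μ ^ k ≤ ‖shellVec X (k : ℤ) (τ k)‖ ^ 2)
    (hclock₁ : ∀ k : ℕ, κ₁ ≤ (bigLam ε₀ ^ 2 * μ) ^ k * (T - τ k) ^ 2)
    (hclock₂ : ∀ k : ℕ, (bigLam ε₀ ^ 2 * μ) ^ k * (T - τ k) ^ 2 ≤ κ₂)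
    (hcf : 0 < cf) (hκ₁ : 0 < κ₁) (hκ₂ : 0 < κ₂) {q : ℕ} (hq : 0 < q) (hT' : 0 < T')
    (hμ' : dssMu ε₀ T' < 1)
    (hasym : ∀ (n : ℤ) (σ : ℝ), Tendsto (fun j : ℕ =>
      W (n + q + (j : ℤ)) (σ + q * T' + -Real.log (T - τ j)) - W (n + (j : ℤ)) (σ + -Real.log (T - τ j)))
        atTop (𝓝 0)) :
    ∃ (q : ℕ) (π : Equiv.Perm (Fin q)) (T : ℝ) (Φ : Fin q → ℝ → Em m),
      IsDSSWave ε₀ α π T Φ ∧ Surviving 1 ε₀ T ∧ ∃ r x, Φ r x ≠ 0 := by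
  have hb : (0 : ℝ) < 1 + ε₀ := by linarith
  have hμ : 0 < μ := lt_of_lt_of_le (inv_pos.2 hb) hμ1
  have hpw : 1 ≤ physWeight 1 ε₀ * (bigLam ε₀ ^ 2 * μ) :=
    physWeight_mul_ge_one_of_surviving hε (a := 1) (by rwa [Real.rpow_neg_one])
  have hq1 : 1 < bigLam ε₀ ^ 2 * μ := by
    rw [bigLam_sq hε]
    have h4 : (1 : ℝ) < (1 + ε₀) ^ 4 := one_lt_pow₀ (by linarith) (by norm_num)
    have h5 : (1 + ε₀) ^ 4 ≤ (1 + ε₀) ^ 5 * μ := by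
      calc (1 + ε₀) ^ 4 = (1 + ε₀) ^ 5 * (1 + ε₀)⁻¹ := by field_simp
        _ ≤ (1 + ε₀) ^ 5 * μ := mul_le_mul_of_nonneg_left hμ1 (pow_pos hb 5).le
    exact lt_of_lt_of_le h4 h5
  obtain ⟨Wlim, hEt, hU, hS, hper⟩ := periodicSurvivingEternalLimit_of_pinned hε hT hC1 hmot hW htypeI hact hμ hE
    hτ hfloor hclock₁ hclock₂ hcf hκ₁ hκ₂ hq1 hpw hasym
  exact (exists_survivingDSSWave_iff_shiftPeriodic hε).2 ⟨Wlim, q, T', hq, hT', hμ', hEt, hU, hper, hS⟩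

/-- **THE CRUX K2(1) `BlowupRigidityOne` BY NAME from ONE blow-up-side bundle.** If for every spread `R ≥ 1` there is a
threshold below which every ROBUST BLOW-UP (`NoGlobalCascade ε₀ α X₀`) of a table `α ∈ E₂(R)` admits SOME exact flow of
`α` on some `[0,T)` that is TYPE I and PINNED at an (S₁)-surviving energy ratio `μ ≥ (1+ε₀)⁻¹` (action ceiling, energy
ceiling `Cₑ μ^k`, firing floor `c_f μ^k` with two-sided clock) AND whose renormalised flow is ASYMPTOTICALLY
`(q,T')`-PERIODIC along its firing centres (`q ≥ 1`, `T' > 0`, `e^{2T'} < (1+ε₀)^5`), then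
`TaoLadderRungTwoBreak.BlowupRigidityOne` holds. («Robust blow-up at fixed spread is asymptotically a surviving DSS
front» ⇒ K2(1), without the classification stub.)
[cite: Tao2016AveragedNS, §4 Thm. 4.2, §6.4; KochNadirashviliSereginSverak2009, Thm 1.1 ff.; cell vocabulary (`NoGlobalCascade`, `IsDSSWave`, `Surviving`)] -/
theorem blowupRigidityOne_of_periodicPinnedBlowups
    (H : ∀ R : ℝ, 1 ≤ R → ∃ εs : ℝ, 0 < εs ∧ ∀ ε₀ : ℝ, 0 < ε₀ → ε₀ ≤ εs →
      ∀ (α : (Fin 4 → Fin 4 → Fin 4 → ℤ × ℤ × ℤ → ℝ)) (X₀ : Fin 4 → ℝ),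
        InTableClass R α → NoGlobalCascade ε₀ α X₀ →
        ∃ (T C A μ Cₑ cf κ₁ κ₂ T' : ℝ) (q : ℕ) (X : Fin 4 → ℤ → ℝ → ℝ) (W : ℤ → ℝ → Em 4) (τ : ℕ → ℝ),
          0 < T ∧
          (∀ i n, ContDiffOn ℝ 1 (X i n) (Set.Ico 0 T)) ∧
          (∀ i n t, 0 ≤ t → t < T → derivWithin (X i n) (Set.Ici 0) t = quadTerm ε₀ α X i n t) ∧
          (∀ n σ, W n σ = (bigLam ε₀ ^ n * Real.exp (-σ)) • shellVec X n (T - Real.exp (-σ))) ∧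
          (∀ (n : ℤ) (t : ℝ), 0 ≤ t → t < T → bigLam ε₀ ^ n * (T - t) * ‖shellVec X n t‖ ≤ C) ∧
          (∀ k : ℤ, IntegrableOn (fun t => ‖shellVec X k t‖) (Ico 0 T) ∧
            bigLam ε₀ ^ k * (∫ t in Ico 0 T, ‖shellVec X k t‖) ≤ A) ∧
          (1 + ε₀)⁻¹ ≤ μ ∧
          (∀ (k : ℤ) (t : ℝ), 0 ≤ t → t < T → ‖shellVec X k t‖ ^ 2 ≤ Cₑ * μ ^ k) ∧
          (∀ k : ℕ, 0 ≤ τ k ∧ τ k < T) ∧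
          (∀ k : ℕ, cf * μ ^ k ≤ ‖shellVec X (k : ℤ) (τ k)‖ ^ 2) ∧
          (∀ k : ℕ, κ₁ ≤ (bigLam ε₀ ^ 2 * μ) ^ k * (T - τ k) ^ 2) ∧
          (∀ k : ℕ, (bigLam ε₀ ^ 2 * μ) ^ k * (T - τ k) ^ 2 ≤ κ₂) ∧
          0 < cf ∧ 0 < κ₁ ∧ 0 < κ₂ ∧ 0 < q ∧ 0 < T' ∧ dssMu ε₀ T' < 1 ∧
          (∀ (n : ℤ) (σ : ℝ), Tendsto (fun j : ℕ =>
            W (n + q + (j : ℤ)) (σ + q * T' + -Real.log (T - τ j)) - W (n + (j : ℤ)) (σ + -Real.log (T - τ j)))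
              atTop (𝓝 0))) :
    BlowupRigidityOne := by
  intro R hR
  obtain ⟨εs, hεs, hH⟩ := H R hR
  refine ⟨εs, hεs, fun ε₀ hε hεle α X₀ hα hNG => ?_⟩
  obtain ⟨T, C, A, μ, Cₑ, cf, κ₁, κ₂, T', q, X, W, τ, hT, hC1, hmot, hW, htypeI, hact, hμ1, hE, hτ, hfloor, hclock₁,
    hclock₂, hcf, hκ₁, hκ₂, hq, hT', hμ', hasym⟩ := hH ε₀ hε hεle α X₀ hα hNG
  exact survivingDSSWave_of_periodicPinned hε hT hC1 hmot hW htypeI hact hμ1 hE hτ hfloor hclock₁ hclock₂ hcf hκ₁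
    hκ₂ hq hT' hμ' hasym

end BlowupRigidityOne

end Summit.NavierStokesRegularity.NavierStokesRegularity.Theorems

end
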